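import Literature.Geometry.Lorentzian.KerrIngoingCoordRiemann
import Literature.Geometry.Lorentzian.KerrIngoingCoordRiemannII
import Literature.Geometry.Lorentzian.KerrIngoingCoordRiemannIII
import Literature.Geometry.Lorentzian.CoordCurvatureNormSq
import HarnessLib

/-!
# The Kerr metric in ingoing Kerr coordinates `(t*, r, μ, φ)`, X: the Kretschmann scalar

Infrastructure (all results proved): **the Kretschmann scalar of the Kerr metric**, computed for the
rational component field `Kerr.Ingoing.bilin M a` in ingoing Kerr coordinates as Topping's square
norm of the curvature tensor `MetricCoord.rmNormSqAt` (`CoordCurvatureNormSq.lean`; `=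
R_{abcd}R^{abcd}` in any signature):

  `|Rm|²(u) = 48 M² (r⁶ − 15 a² r⁴ μ² + 15 a⁴ r² μ⁴ − a⁶ μ⁶)/(r² + a²μ²)⁶ = 48 M² Re (r + iaμ)⁶/Σ⁶`

(`Kerr.Ingoing.rmNormSqAt_bilin`; Henry, Astrophys. J. 535 (2000) 350 with `Q = 0`; Cherubini, Bini,
Capozziello, Ruffini, Int. J. Mod. Phys. D 11 (2002) 827, §4), on the regular set `{Σ ≠ 0, μ² ≠ 1}`,
for all real `M, a`. Proof: `rmNormSqAt_eq_sum` in the coordinate basis with `g⁻¹ = ginvMat` is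
regrouped through the partial contractions `S_{AA'} = Σ_{cc'} g^{cc'} tr(R(∂_A,∂_c)
R(∂_{A'},∂_{c'}))` (`rmNormSqAt_eq_sum_ginvMat`), each a short combination of traces `tr(R(∂_A,∂_C)
∘ R(∂_{A'},∂_{C'}))` computed from the matrices of `KerrIngoingCoordRiemann{,II,III}.lean`
(`Kerr.Ingoing.trace_comp_of_matrix`); every layer is a rational identity closed by
`field_simp`/`ring`. The transfer to the Kerr–Schild chart `Kerr.bilin M a` (naturality
`MetricCoord.rmNormSqAt_pullMetric` along the ingoing chart, density off the axis) is done where it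
is used. The closed forms were generated by computer algebra (exact rational arithmetic over `ℚ(r,
μ, M, a)`) and are checked here by Lean; nothing is taken on trust. Exponents are written `^ (n :
ℕ)` in the generated expressions: fixing the exponent type up front keeps their elaboration fast.

## References

* R. P. Kerr, Phys. Rev. Lett. 11 (1963) 237–238; R. P. Kerr, A. Schild, *A new class of vacuum
  solutions of the Einstein field equations* (1965), §3.
* B. O'Neill, *Semi-Riemannian geometry* (1983), Ch. 3, Prop. 3.13, Lemma 3.38, Prop. 3.36.
* M. Visser, *The Kerr spacetime: a brief introduction*, arXiv:0706.0622, (E:K1)–(E:K2).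
* R. C. Henry, *Kretschmann scalar for a Kerr–Newman black hole*, Astrophys. J. 535 (2000) 350.
* C. Cherubini, D. Bini, S. Capozziello, R. Ruffini, *Second order scalar invariants of the Riemann
  tensor*, Int. J. Mod. Phys. D 11 (2002) 827–841, §4.
* P. Topping, *Lectures on the Ricci flow* (2006), §3.2, (3.2.4).
-/

noncomputable section

set_option maxSynthPendingDepth 3

open Set Function Module
open scoped ContDiff Topology
open Literature.Geometry.Lorentzian.MetricCoord

namespace Literature.Geometry.Lorentzian

namespace Kerr

namespace Ingoing

variable (M a : ℝ) {u : E4}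

/-! ### Regrouping `|Rm|²` through the partial contractions -/

/-- `|Rm|²` of the Kerr components through the partial contractions
`S_{AA'} = Σ_{cc'} g^{cc'} tr(R(∂_A,∂_c) ∘ R(∂_{A'},∂_{c'}))`: `|Rm|² = −Σ_{AA'} g^{AA'} S_{AA'}`
(`MetricCoord.rmNormSqAt_eq_sum` in the coordinate basis, with `g⁻¹ = ginvMat`).
[cite: Topping2006, §3.2, (3.2.4)] -/
theorem rmNormSqAt_eq_sum_ginvMat (hu : u ∈ regularSet a) :
    rmNormSqAt (bilin M a) u = -∑ A, ∑ A', ginvMat M a u A A' *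
      ∑ c, ∑ c', ginvMat M a u c c' * traceCLM E4 ((riemAt (bilin M a) u (E4.basisVector A)
        (E4.basisVector c)).comp (riemAt (bilin M a) u (E4.basisVector A') (E4.basisVector c'))) :=
        by
  rw [rmNormSqAt_eq_sum (EuclideanSpace.basisFun (Fin 4) ℝ).toBasis]
  simp only [ginv_basisFun M a hu, basisFun_toBasis_apply]
  congr 1
  refine Finset.sum_congr rfl fun A _ ↦ Finset.sum_congr rfl fun A' _ ↦ ?_
  rw [Finset.mul_sum]
  refine Finset.sum_congr rfl fun c _ ↦ ?_
  rw [Finset.mul_sum]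
  refine Finset.sum_congr rfl fun c' _ ↦ ?_
  ring

/-- Contraction with the inverse Kerr form: only the eight nonzero entries of `ginvMat` survive.
[cite: arXiv07060622, (E:K2)] -/
theorem sum_ginvMat_mul (f : Fin 4 → Fin 4 → ℝ) :
    ∑ A, ∑ A', ginvMat M a u A A' * f A A' =
      ginvMat M a u 0 0 * f 0 0 +
      ginvMat M a u 0 1 * f 0 1 +
      ginvMat M a u 1 0 * f 1 0 +
      ginvMat M a u 1 1 * f 1 1 +
      ginvMat M a u 1 3 * f 1 3 +
      ginvMat M a u 2 2 * f 2 2 +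
      ginvMat M a u 3 1 * f 3 1 +
      ginvMat M a u 3 3 * f 3 3 := by
  simp only [Fin.sum_univ_four, ginvMat, Matrix.of_apply, Matrix.cons_val', Matrix.cons_val_zero,
    Matrix.cons_val_one, Matrix.cons_val, Matrix.empty_val', Matrix.cons_val_fin_one, zero_mul,
    add_zero, zero_add]
  ring

/-- The partial contractions are symmetric: `S_{A'A} = S_{AA'}` (`g⁻¹` symmetric, `tr(XY) =
tr(YX)`).
[folklore] -/
theorem quadContr_comm (A A' : Fin 4) :
    (∑ c, ∑ c', ginvMat M a u c c' * traceCLM E4 ((riemAt (bilin M a) u (E4.basisVector A')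
        (E4.basisVector c)).comp (riemAt (bilin M a) u (E4.basisVector A) (E4.basisVector c')))) =
      ∑ c, ∑ c', ginvMat M a u c c' * traceCLM E4 ((riemAt (bilin M a) u (E4.basisVector A)
        (E4.basisVector c)).comp (riemAt (bilin M a) u (E4.basisVector A') (E4.basisVector c'))) :=
        by
  rw [Finset.sum_comm]
  refine Finset.sum_congr rfl fun c _ ↦ Finset.sum_congr rfl fun c' _ ↦ ?_
  rw [ginvMat_symm, traceCLM_comp_comm]

/-! ### The partial contractions in closed form -/

set_option maxHeartbeats 800000 in
/-- **The partial contraction `S_{00} = Σ_{cc'} g^{cc'} tr(R(∂_0,∂_c) ∘ R(∂_0,∂_{c'}))`** of the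
curvature of the Kerr components in closed form (from the matrices of `R(∂_A,∂_C)`,
`Kerr.Ingoing.trace_comp_of_matrix`, and `field_simp`/`ring`). [cite: KerrSchild1965, §3] -/
theorem quadContr_00 (hu : u ∈ regularSet a) :
    (∑ c, ∑ c', ginvMat M a u c c' * traceCLM E4 ((riemAt (bilin M a) u (E4.basisVector 0)
        (E4.basisVector c)).comp (riemAt (bilin M a) u (E4.basisVector 0) (E4.basisVector c')))) =
      (-(12 * u 2 ^ (8 : ℕ) * M ^ (2 : ℕ) * a ^ (8 : ℕ)) +
        24 * u 1 * u 2 ^ (6 : ℕ) * M ^ (3 : ℕ) * a ^ (6 : ℕ) +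
        168 * u 1 ^ (2 : ℕ) * u 2 ^ (6 : ℕ) * M ^ (2 : ℕ) * a ^ (6 : ℕ) -
        360 * u 1 ^ (3 : ℕ) * u 2 ^ (4 : ℕ) * M ^ (3 : ℕ) * a ^ (4 : ℕ) +
        360 * u 1 ^ (5 : ℕ) * u 2 ^ (2 : ℕ) * M ^ (3 : ℕ) * a ^ (2 : ℕ) -
        168 * u 1 ^ (6 : ℕ) * u 2 ^ (2 : ℕ) * M ^ (2 : ℕ) * a ^ (2 : ℕ) -
        24 * u 1 ^ (7 : ℕ) * M ^ (3 : ℕ) +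
        12 * u 1 ^ (8 : ℕ) * M ^ (2 : ℕ)) / sigma a u ^ (7 : ℕ) := by
  have hS := hu.1
  have hP := hu.2
  simp only [Fin.sum_univ_four, ginvMat, Matrix.of_apply, Matrix.cons_val', Matrix.cons_val_zero,
    Matrix.cons_val_one, Matrix.cons_val, Matrix.empty_val', Matrix.cons_val_fin_one, riemAt_self,
    ContinuousLinearMap.zero_comp, ContinuousLinearMap.comp_zero, map_zero,
    traceCLM_comp_comm (riemAt (bilin M a) u (E4.basisVector 0) (E4.basisVector 3)) (riemAt (bilin
    M a) u (E4.basisVector 0) (E4.basisVector 1)), mul_zero, zero_mul, add_zero, zero_add]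
  rw [trace_comp_of_matrix _ _ _ _ (riem_01 M a hu) (riem_01 M a hu),
    trace_comp_of_matrix _ _ _ _ (riem_01 M a hu) (riem_03 M a hu),
    trace_comp_of_matrix _ _ _ _ (riem_02 M a hu) (riem_02 M a hu),
    trace_comp_of_matrix _ _ _ _ (riem_03 M a hu) (riem_03 M a hu)]
  simp only [Fin.sum_univ_four, Matrix.of_apply, Matrix.cons_val', Matrix.cons_val_zero,
    Matrix.cons_val_one, Matrix.cons_val, Matrix.empty_val', Matrix.cons_val_fin_one, h00, scalarH,
    mul_zero, zero_mul, add_zero, zero_add]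
  field_simp
  simp only [sigma, sinSq]
  ring

set_option maxHeartbeats 800000 in
/-- **The partial contraction `S_{01} = Σ_{cc'} g^{cc'} tr(R(∂_0,∂_c) ∘ R(∂_1,∂_{c'}))`** of the
curvature of the Kerr components in closed form (from the matrices of `R(∂_A,∂_C)`,
`Kerr.Ingoing.trace_comp_of_matrix`, and `field_simp`/`ring`). [cite: KerrSchild1965, §3] -/
theorem quadContr_01 (hu : u ∈ regularSet a) :
    (∑ c, ∑ c', ginvMat M a u c c' * traceCLM E4 ((riemAt (bilin M a) u (E4.basisVector 0)
        (E4.basisVector c)).comp (riemAt (bilin M a) u (E4.basisVector 1) (E4.basisVector c')))) =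
      (24 * u 1 * u 2 ^ (6 : ℕ) * M ^ (3 : ℕ) * a ^ (6 : ℕ) -
        360 * u 1 ^ (3 : ℕ) * u 2 ^ (4 : ℕ) * M ^ (3 : ℕ) * a ^ (4 : ℕ) +
        360 * u 1 ^ (5 : ℕ) * u 2 ^ (2 : ℕ) * M ^ (3 : ℕ) * a ^ (2 : ℕ) -
        24 * u 1 ^ (7 : ℕ) * M ^ (3 : ℕ)) / sigma a u ^ (7 : ℕ) := by
  have hS := hu.1
  have hP := hu.2
  simp only [Fin.sum_univ_four, ginvMat, Matrix.of_apply, Matrix.cons_val', Matrix.cons_val_zero,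
    Matrix.cons_val_one, Matrix.cons_val, Matrix.empty_val', Matrix.cons_val_fin_one, riemAt_self,
    ContinuousLinearMap.zero_comp, ContinuousLinearMap.comp_zero, map_zero,
    riemAt_swap (bilin M a) u (E4.basisVector 0) (E4.basisVector 1), ContinuousLinearMap.comp_neg,
    map_neg, mul_neg, mul_zero, zero_mul, add_zero, zero_add, neg_zero]
  rw [trace_comp_of_matrix _ _ _ _ (riem_01 M a hu) (riem_01 M a hu),
    trace_comp_of_matrix _ _ _ _ (riem_01 M a hu) (riem_13 M a hu),
    trace_comp_of_matrix _ _ _ _ (riem_02 M a hu) (riem_12 M a hu),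
    trace_comp_of_matrix _ _ _ _ (riem_03 M a hu) (riem_13 M a hu)]
  simp only [Fin.sum_univ_four, Matrix.of_apply, Matrix.cons_val', Matrix.cons_val_zero,
    Matrix.cons_val_one, Matrix.cons_val, Matrix.empty_val', Matrix.cons_val_fin_one, h00, scalarH,
    mul_zero, zero_mul, add_zero, zero_add]
  field_simp
  simp only [sigma, sinSq]
  ring

set_option maxHeartbeats 800000 in
/-- **The partial contraction `S_{11} = Σ_{cc'} g^{cc'} tr(R(∂_1,∂_c) ∘ R(∂_1,∂_{c'}))`** of the
curvature of the Kerr components in closed form (from the matrices of `R(∂_A,∂_C)`,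
`Kerr.Ingoing.trace_comp_of_matrix`, and `field_simp`/`ring`). [cite: KerrSchild1965, §3] -/
theorem quadContr_11 (hu : u ∈ regularSet a) :
    (∑ c, ∑ c', ginvMat M a u c c' * traceCLM E4 ((riemAt (bilin M a) u (E4.basisVector 1)
        (E4.basisVector c)).comp (riemAt (bilin M a) u (E4.basisVector 1) (E4.basisVector c')))) =
      (12 * u 2 ^ (8 : ℕ) * M ^ (2 : ℕ) * a ^ (8 : ℕ) +
        24 * u 1 * u 2 ^ (6 : ℕ) * M ^ (3 : ℕ) * a ^ (6 : ℕ) -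
        168 * u 1 ^ (2 : ℕ) * u 2 ^ (6 : ℕ) * M ^ (2 : ℕ) * a ^ (6 : ℕ) -
        360 * u 1 ^ (3 : ℕ) * u 2 ^ (4 : ℕ) * M ^ (3 : ℕ) * a ^ (4 : ℕ) +
        360 * u 1 ^ (5 : ℕ) * u 2 ^ (2 : ℕ) * M ^ (3 : ℕ) * a ^ (2 : ℕ) +
        168 * u 1 ^ (6 : ℕ) * u 2 ^ (2 : ℕ) * M ^ (2 : ℕ) * a ^ (2 : ℕ) -
        24 * u 1 ^ (7 : ℕ) * M ^ (3 : ℕ) -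
        12 * u 1 ^ (8 : ℕ) * M ^ (2 : ℕ)) / sigma a u ^ (7 : ℕ) := by
  have hS := hu.1
  have hP := hu.2
  simp only [Fin.sum_univ_four, ginvMat, Matrix.of_apply, Matrix.cons_val', Matrix.cons_val_zero,
    Matrix.cons_val_one, Matrix.cons_val, Matrix.empty_val', Matrix.cons_val_fin_one, riemAt_self,
    ContinuousLinearMap.zero_comp, ContinuousLinearMap.comp_zero, map_zero,
    riemAt_swap (bilin M a) u (E4.basisVector 0) (E4.basisVector 1), ContinuousLinearMap.neg_comp,
    ContinuousLinearMap.comp_neg, map_neg, mul_neg, neg_mul, neg_neg, mul_zero, zero_mul, add_zero,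
    zero_add, neg_zero]
  rw [trace_comp_of_matrix _ _ _ _ (riem_01 M a hu) (riem_01 M a hu),
    trace_comp_of_matrix _ _ _ _ (riem_12 M a hu) (riem_12 M a hu),
    trace_comp_of_matrix _ _ _ _ (riem_13 M a hu) (riem_13 M a hu)]
  simp only [Fin.sum_univ_four, Matrix.of_apply, Matrix.cons_val', Matrix.cons_val_zero,
    Matrix.cons_val_one, Matrix.cons_val, Matrix.empty_val', Matrix.cons_val_fin_one, h00, scalarH,
    mul_zero, add_zero]
  field_simp
  simp only [sigma, sinSq]
  ring

set_option maxHeartbeats 800000 in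
/-- **The partial contraction `S_{13} = Σ_{cc'} g^{cc'} tr(R(∂_1,∂_c) ∘ R(∂_3,∂_{c'}))`** of the
curvature of the Kerr components in closed form (from the matrices of `R(∂_A,∂_C)`,
`Kerr.Ingoing.trace_comp_of_matrix`, and `field_simp`/`ring`). [cite: KerrSchild1965, §3] -/
theorem quadContr_13 (hu : u ∈ regularSet a) :
    (∑ c, ∑ c', ginvMat M a u c c' * traceCLM E4 ((riemAt (bilin M a) u (E4.basisVector 1)
        (E4.basisVector c)).comp (riemAt (bilin M a) u (E4.basisVector 3) (E4.basisVector c')))) =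
      (12 * u 2 ^ (10 : ℕ) * M ^ (2 : ℕ) * a ^ (9 : ℕ) -
        12 * u 2 ^ (8 : ℕ) * M ^ (2 : ℕ) * a ^ (9 : ℕ) +
        24 * u 1 * u 2 ^ (8 : ℕ) * M ^ (3 : ℕ) * a ^ (7 : ℕ) -
        168 * u 1 ^ (2 : ℕ) * u 2 ^ (8 : ℕ) * M ^ (2 : ℕ) * a ^ (7 : ℕ) -
        24 * u 1 * u 2 ^ (6 : ℕ) * M ^ (3 : ℕ) * a ^ (7 : ℕ) +
        168 * u 1 ^ (2 : ℕ) * u 2 ^ (6 : ℕ) * M ^ (2 : ℕ) * a ^ (7 : ℕ) -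
        360 * u 1 ^ (3 : ℕ) * u 2 ^ (6 : ℕ) * M ^ (3 : ℕ) * a ^ (5 : ℕ) +
        360 * u 1 ^ (3 : ℕ) * u 2 ^ (4 : ℕ) * M ^ (3 : ℕ) * a ^ (5 : ℕ) +
        360 * u 1 ^ (5 : ℕ) * u 2 ^ (4 : ℕ) * M ^ (3 : ℕ) * a ^ (3 : ℕ) +
        168 * u 1 ^ (6 : ℕ) * u 2 ^ (4 : ℕ) * M ^ (2 : ℕ) * a ^ (3 : ℕ) -
        360 * u 1 ^ (5 : ℕ) * u 2 ^ (2 : ℕ) * M ^ (3 : ℕ) * a ^ (3 : ℕ) -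
        168 * u 1 ^ (6 : ℕ) * u 2 ^ (2 : ℕ) * M ^ (2 : ℕ) * a ^ (3 : ℕ) -
        24 * u 1 ^ (7 : ℕ) * u 2 ^ (2 : ℕ) * M ^ (3 : ℕ) * a -
        12 * u 1 ^ (8 : ℕ) * u 2 ^ (2 : ℕ) * M ^ (2 : ℕ) * a +
        24 * u 1 ^ (7 : ℕ) * M ^ (3 : ℕ) * a +
        12 * u 1 ^ (8 : ℕ) * M ^ (2 : ℕ) * a) / sigma a u ^ (7 : ℕ) := by
  have hS := hu.1
  have hP := hu.2
  simp only [Fin.sum_univ_four, ginvMat, Matrix.of_apply, Matrix.cons_val', Matrix.cons_val_zero,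
    Matrix.cons_val_one, Matrix.cons_val, Matrix.empty_val', Matrix.cons_val_fin_one, riemAt_self,
    ContinuousLinearMap.zero_comp, ContinuousLinearMap.comp_zero, map_zero,
    riemAt_swap (bilin M a) u (E4.basisVector 0) (E4.basisVector 1),
    riemAt_swap (bilin M a) u (E4.basisVector 0) (E4.basisVector 3),
    riemAt_swap (bilin M a) u (E4.basisVector 1) (E4.basisVector 3),
    riemAt_swap (bilin M a) u (E4.basisVector 2) (E4.basisVector 3), ContinuousLinearMap.neg_comp,
    ContinuousLinearMap.comp_neg, map_neg, mul_neg, neg_mul, neg_neg, mul_zero, zero_mul, add_zero,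
    zero_add, neg_zero]
  rw [trace_comp_of_matrix _ _ _ _ (riem_01 M a hu) (riem_03 M a hu),
    trace_comp_of_matrix _ _ _ _ (riem_01 M a hu) (riem_13 M a hu),
    trace_comp_of_matrix _ _ _ _ (riem_12 M a hu) (riem_23 M a hu),
    trace_comp_of_matrix _ _ _ _ (riem_13 M a hu) (riem_13 M a hu)]
  simp only [Fin.sum_univ_four, Matrix.of_apply, Matrix.cons_val', Matrix.cons_val_zero,
    Matrix.cons_val_one, Matrix.cons_val, Matrix.empty_val', Matrix.cons_val_fin_one, h00, scalarH,
    mul_zero, add_zero]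
  field_simp
  simp only [sigma, sinSq]
  ring

set_option maxHeartbeats 800000 in
/-- **The partial contraction `S_{22} = Σ_{cc'} g^{cc'} tr(R(∂_2,∂_c) ∘ R(∂_2,∂_{c'}))`** of the
curvature of the Kerr components in closed form (from the matrices of `R(∂_A,∂_C)`,
`Kerr.Ingoing.trace_comp_of_matrix`, and `field_simp`/`ring`). [cite: KerrSchild1965, §3] -/
theorem quadContr_22 (hu : u ∈ regularSet a) :
    (∑ c, ∑ c', ginvMat M a u c c' * traceCLM E4 ((riemAt (bilin M a) u (E4.basisVector 2)
        (E4.basisVector c)).comp (riemAt (bilin M a) u (E4.basisVector 2) (E4.basisVector c')))) =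
      (12 * u 2 ^ (6 : ℕ) * M ^ (2 : ℕ) * a ^ (6 : ℕ) -
        180 * u 1 ^ (2 : ℕ) * u 2 ^ (4 : ℕ) * M ^ (2 : ℕ) * a ^ (4 : ℕ) +
        180 * u 1 ^ (4 : ℕ) * u 2 ^ (2 : ℕ) * M ^ (2 : ℕ) * a ^ (2 : ℕ) -
        12 * u 1 ^ (6 : ℕ) * M ^ (2 : ℕ)) / (sigma a u ^ (5 : ℕ) * sinSq u) := by
  have hS := hu.1
  have hP := hu.2
  simp only [Fin.sum_univ_four, ginvMat, Matrix.of_apply, Matrix.cons_val', Matrix.cons_val_zero,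
    Matrix.cons_val_one, Matrix.cons_val, Matrix.empty_val', Matrix.cons_val_fin_one, riemAt_self,
    ContinuousLinearMap.zero_comp, ContinuousLinearMap.comp_zero, map_zero,
    riemAt_swap (bilin M a) u (E4.basisVector 0) (E4.basisVector 2),
    riemAt_swap (bilin M a) u (E4.basisVector 1) (E4.basisVector 2), ContinuousLinearMap.neg_comp,
    ContinuousLinearMap.comp_neg, map_neg,
    traceCLM_comp_comm (riemAt (bilin M a) u (E4.basisVector 1) (E4.basisVector 2)) (riemAt (bilin
    M a) u (E4.basisVector 0) (E4.basisVector 2)),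
    traceCLM_comp_comm (riemAt (bilin M a) u (E4.basisVector 2) (E4.basisVector 3)) (riemAt (bilin
    M a) u (E4.basisVector 1) (E4.basisVector 2)), mul_neg, neg_mul, neg_neg, mul_zero, zero_mul,
    add_zero, zero_add, neg_zero]
  rw [trace_comp_of_matrix _ _ _ _ (riem_02 M a hu) (riem_02 M a hu),
    trace_comp_of_matrix _ _ _ _ (riem_02 M a hu) (riem_12 M a hu),
    trace_comp_of_matrix _ _ _ _ (riem_12 M a hu) (riem_12 M a hu),
    trace_comp_of_matrix _ _ _ _ (riem_12 M a hu) (riem_23 M a hu),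
    trace_comp_of_matrix _ _ _ _ (riem_23 M a hu) (riem_23 M a hu)]
  simp only [Fin.sum_univ_four, Matrix.of_apply, Matrix.cons_val', Matrix.cons_val_zero,
    Matrix.cons_val_one, Matrix.cons_val, Matrix.empty_val', Matrix.cons_val_fin_one, h00, scalarH,
    mul_zero, zero_mul, add_zero]
  field_simp
  simp only [sigma, sinSq]
  ring

set_option maxHeartbeats 800000 in
/-- **The partial contraction `S_{33} = Σ_{cc'} g^{cc'} tr(R(∂_3,∂_c) ∘ R(∂_3,∂_{c'}))`** of the
curvature of the Kerr components in closed form (from the matrices of `R(∂_A,∂_C)`,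
`Kerr.Ingoing.trace_comp_of_matrix`, and `field_simp`/`ring`). [cite: KerrSchild1965, §3] -/
theorem quadContr_33 (hu : u ∈ regularSet a) :
    (∑ c, ∑ c', ginvMat M a u c c' * traceCLM E4 ((riemAt (bilin M a) u (E4.basisVector 3)
        (E4.basisVector c)).comp (riemAt (bilin M a) u (E4.basisVector 3) (E4.basisVector c')))) =
      (-(12 * u 2 ^ (10 : ℕ) * M ^ (2 : ℕ) * a ^ (10 : ℕ)) +
        24 * u 1 * u 2 ^ (10 : ℕ) * M ^ (3 : ℕ) * a ^ (8 : ℕ) -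
        12 * u 1 ^ (2 : ℕ) * u 2 ^ (10 : ℕ) * M ^ (2 : ℕ) * a ^ (8 : ℕ) +
        12 * u 2 ^ (8 : ℕ) * M ^ (2 : ℕ) * a ^ (10 : ℕ) -
        48 * u 1 * u 2 ^ (8 : ℕ) * M ^ (3 : ℕ) * a ^ (8 : ℕ) +
        180 * u 1 ^ (2 : ℕ) * u 2 ^ (8 : ℕ) * M ^ (2 : ℕ) * a ^ (8 : ℕ) -
        360 * u 1 ^ (3 : ℕ) * u 2 ^ (8 : ℕ) * M ^ (3 : ℕ) * a ^ (6 : ℕ) +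
        168 * u 1 ^ (4 : ℕ) * u 2 ^ (8 : ℕ) * M ^ (2 : ℕ) * a ^ (6 : ℕ) +
        24 * u 1 * u 2 ^ (6 : ℕ) * M ^ (3 : ℕ) * a ^ (8 : ℕ) -
        168 * u 1 ^ (2 : ℕ) * u 2 ^ (6 : ℕ) * M ^ (2 : ℕ) * a ^ (8 : ℕ) +
        720 * u 1 ^ (3 : ℕ) * u 2 ^ (6 : ℕ) * M ^ (3 : ℕ) * a ^ (6 : ℕ) -
        168 * u 1 ^ (4 : ℕ) * u 2 ^ (6 : ℕ) * M ^ (2 : ℕ) * a ^ (6 : ℕ) +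
        360 * u 1 ^ (5 : ℕ) * u 2 ^ (6 : ℕ) * M ^ (3 : ℕ) * a ^ (4 : ℕ) -
        360 * u 1 ^ (3 : ℕ) * u 2 ^ (4 : ℕ) * M ^ (3 : ℕ) * a ^ (6 : ℕ) -
        720 * u 1 ^ (5 : ℕ) * u 2 ^ (4 : ℕ) * M ^ (3 : ℕ) * a ^ (4 : ℕ) -
        168 * u 1 ^ (6 : ℕ) * u 2 ^ (4 : ℕ) * M ^ (2 : ℕ) * a ^ (4 : ℕ) -
        24 * u 1 ^ (7 : ℕ) * u 2 ^ (4 : ℕ) * M ^ (3 : ℕ) * a ^ (2 : ℕ) -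
        168 * u 1 ^ (8 : ℕ) * u 2 ^ (4 : ℕ) * M ^ (2 : ℕ) * a ^ (2 : ℕ) +
        360 * u 1 ^ (5 : ℕ) * u 2 ^ (2 : ℕ) * M ^ (3 : ℕ) * a ^ (4 : ℕ) +
        168 * u 1 ^ (6 : ℕ) * u 2 ^ (2 : ℕ) * M ^ (2 : ℕ) * a ^ (4 : ℕ) +
        48 * u 1 ^ (7 : ℕ) * u 2 ^ (2 : ℕ) * M ^ (3 : ℕ) * a ^ (2 : ℕ) +
        180 * u 1 ^ (8 : ℕ) * u 2 ^ (2 : ℕ) * M ^ (2 : ℕ) * a ^ (2 : ℕ) +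
        12 * u 1 ^ (10 : ℕ) * u 2 ^ (2 : ℕ) * M ^ (2 : ℕ) -
        24 * u 1 ^ (7 : ℕ) * M ^ (3 : ℕ) * a ^ (2 : ℕ) -
        12 * u 1 ^ (8 : ℕ) * M ^ (2 : ℕ) * a ^ (2 : ℕ) -
        12 * u 1 ^ (10 : ℕ) * M ^ (2 : ℕ)) / sigma a u ^ (7 : ℕ) := by
  have hS := hu.1
  have hP := hu.2
  simp only [Fin.sum_univ_four, ginvMat, Matrix.of_apply, Matrix.cons_val', Matrix.cons_val_zero,
    Matrix.cons_val_one, Matrix.cons_val, Matrix.empty_val', Matrix.cons_val_fin_one, riemAt_self,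
    ContinuousLinearMap.zero_comp, ContinuousLinearMap.comp_zero, map_zero,
    riemAt_swap (bilin M a) u (E4.basisVector 0) (E4.basisVector 3),
    riemAt_swap (bilin M a) u (E4.basisVector 1) (E4.basisVector 3),
    riemAt_swap (bilin M a) u (E4.basisVector 2) (E4.basisVector 3), ContinuousLinearMap.neg_comp,
    ContinuousLinearMap.comp_neg, map_neg,
    traceCLM_comp_comm (riemAt (bilin M a) u (E4.basisVector 1) (E4.basisVector 3)) (riemAt (bilin
    M a) u (E4.basisVector 0) (E4.basisVector 3)), mul_neg, neg_mul, neg_neg, mul_zero, zero_mul,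
    add_zero, zero_add, neg_zero]
  rw [trace_comp_of_matrix _ _ _ _ (riem_03 M a hu) (riem_03 M a hu),
    trace_comp_of_matrix _ _ _ _ (riem_03 M a hu) (riem_13 M a hu),
    trace_comp_of_matrix _ _ _ _ (riem_13 M a hu) (riem_13 M a hu),
    trace_comp_of_matrix _ _ _ _ (riem_23 M a hu) (riem_23 M a hu)]
  simp only [Fin.sum_univ_four, Matrix.of_apply, Matrix.cons_val', Matrix.cons_val_zero,
    Matrix.cons_val_one, Matrix.cons_val, Matrix.empty_val', Matrix.cons_val_fin_one, h00, scalarH,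
    mul_zero, zero_mul, add_zero, zero_add]
  field_simp
  simp only [sigma, sinSq]
  ring

/-! ### The Kretschmann scalar -/

/-- **The Kretschmann scalar of the Kerr metric in ingoing Kerr coordinates**: for the rational
component field `Kerr.Ingoing.bilin M a` at every point of the regular set `{Σ ≠ 0, μ² ≠ 1}`,
`|Rm|² = −Σ g^{aa'}g^{cc'} tr(R(∂_a,∂_c)R(∂_{a'},∂_{c'})) (= R_{abcd}R^{abcd})
 = 48 M² (r⁶ − 15 a² r⁴ μ² + 15 a⁴ r² μ⁴ − a⁶ μ⁶)/Σ⁶ = 48 M² Re (r + i a μ)⁶/Σ⁶`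
(`Σ = r² + a²μ²`; Henry, Astrophys. J. 535 (2000) 350, eq. for `Q = 0`; the type-D form
`48 Re Ψ₂²`, `Ψ₂ = −M/(r − i a μ)³`), for all real `M, a` (no sign or extremality condition).
[cite: KerrSchild1965, §3] -/
theorem rmNormSqAt_bilin (hu : u ∈ regularSet a) :
    rmNormSqAt (bilin M a) u = (-(48 * u 2 ^ (6 : ℕ) * M ^ (2 : ℕ) * a ^ (6 : ℕ)) +
      720 * u 1 ^ (2 : ℕ) * u 2 ^ (4 : ℕ) * M ^ (2 : ℕ) * a ^ (4 : ℕ) -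
      720 * u 1 ^ (4 : ℕ) * u 2 ^ (2 : ℕ) * M ^ (2 : ℕ) * a ^ (2 : ℕ) +
      48 * u 1 ^ (6 : ℕ) * M ^ (2 : ℕ)) / sigma a u ^ (6 : ℕ) := by
  have hS := hu.1
  have hP := hu.2
  rw [rmNormSqAt_eq_sum_ginvMat M a hu, sum_ginvMat_mul, quadContr_comm M a 0 1,
    quadContr_comm M a 1 3, quadContr_00 M a hu, quadContr_01 M a hu, quadContr_11 M a hu,
    quadContr_13 M a hu, quadContr_22 M a hu, quadContr_33 M a hu]
  simp only [ginvMat, Matrix.of_apply, Matrix.cons_val', Matrix.cons_val_zero, Matrix.cons_val_one,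
    Matrix.cons_val, Matrix.empty_val', Matrix.cons_val_fin_one, h00, scalarH]
  field_simp
  simp only [sigma, sinSq]
  ring

end Ingoing

end Kerr

end Literature.Geometry.Lorentzian

end
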